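import Literature.AlgebraicGeometry.AbelianSchemes.AbelianSchemeBaseChangeComp
import Literature.AlgebraicGeometry.AbelianSchemes.AbelianSchemeOverFibreIdentity
import Literature.AlgebraicGeometry.AbelianSchemes.PolarizedAbelianSchemeWithLevelBaseChange
import HarnessLib

/-!
# The slice of a fibrewise-`Pic⁰` rigidified line bundle at a rational point is homogeneous of rank one

Layer `Literature/AlgebraicGeometry/AbelianSchemes`, namespace
`Literature.AlgebraicGeometry.AbelianSchemes.AbelianSchemeOver`. THEOREMS ONLY; no named fact, no definition, no
instance, no notation. Cell `hodgecm-mathlib` (D-0151), M1PRIME-DAG rung 0, J0b road (i): input (ε) «the slice of `ℒ` at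
a `ℂ`-point is homogeneous of rank one» (the S4 seam) of the (R3a) assembly «`DualPair.universal` for `(A/K(Θ), 𝒫)`
over normal bases» (B-p02 lineage), written against ★ `AbelianSchemes/AbelianSchemeDualPair` (D2 currency
`RigidifiedLineBundle` / `fibreModule` / `FibrewisePicZero`).

For an abelian variety `A₀` over an ALGEBRAICALLY CLOSED field `K`, `A := AbelianSchemeOver.ofAbelianVariety A₀`, a
`K`-scheme `f : T → Spec K`, a rigidified line bundle `ℒ` on `A_T = A₀ ×_K T` lying fibrewise in `Pic⁰`
([MilneAV2008, I §8] conditions (a′)/(b′); [MumfordAV1970, §8 (iv) ⇔ (i)]: «`L ∈ Pic⁰(X)` ⟺ `T_x^*L ≅ L` for all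
`x ∈ X`») and a rational point `t : Spec K → T` (`t ≫ f = 𝟙`):

* `fibreCongrIso_hom_toSchemeHom_fst` — bookkeeping: the transport ★ `fibreCongrIso` along an equality of base points
  commutes with the projections to `A`;
* `exists_fibreIso_toSchemeHom_eq` — the fibre `(A_T)_t` at a rational point `t` is isomorphic to `A₀` as an abelian
  variety, through an isomorphism whose scheme map is `pr₁ ≫ pr₁ : (A₀ ×_K T) ×_T Spec K → A₀`
  (★ `fibreBaseChangeIso` ≪≫ ★ `fibreCongrIso` ≪≫ ★ `fibreIdIso`);
* **`isHomogeneous_pullback_of_fibrewisePicZero`** — for ANY slice map `s : A₀ → A₀ ×_K T` at `t` (`s ≫ pr₁ = 𝟙`,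
  `s ≫ pr₂ = π_{A₀} ≫ t`), the module `s^* ℒ` on `A₀` is homogeneous (`t_P^*(s^*ℒ) ≅ s^*ℒ` for all `P ∈ A₀(K)`): the
  hypothesis `FibrewisePicZero` at the geometric point `t` says that `ℒ_t` is homogeneous on the FIBRE abelian variety
  `(A_T)_t`, and homogeneity is transported along the identification `(A_T)_t ≅ A_{t ≫ f} = A_{𝟙} ≅ A₀` of abelian
  varieties (★ `fibreBaseChangeIso`, ★ `fibreCongrIso`, ★ `fibreIdIso`; ★ `isHomogeneous_pullback_iff_of_iso`), whose
  underlying scheme map followed by `pr₁ : (A_T)_t → A_T` is the slice `s`;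
* `hasRank_pullback_L` — `s^* ℒ` is a line bundle (★ `hasRank_pullback`);
* **`isHomogeneous_slice_of_fibrewisePicZero`** / `hasRank_slice` — the same for the slice
  `((ρ_ A₀.X).inv ≫ A₀.X ◁ t₀).left` at a rational point `t₀ : 𝟙 ⟶ T` of the cartesian-monoidal `Over (Spec K)`
  (the spelling consumed by the (R3a) assembly; output shape of ★ `exists_detClass_eq_detClass_pullback_sliceAt
  (hM1 : HasRank M 1) (hM : IsHomogeneous A M)`);
* `isHomogeneous_sliceAt_of_fibrewisePicZero` / `hasRank_sliceAt` — the same for the slice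
  `(lift (𝟙 A₀.X) (toSpecOver A₀.X ≫ x)).left` at an `AlgPoints` point `x : Spec K → T` (the ★ `PoincareSheafSlicesPoints`
  spelling).

(`FibrewisePicZero` quantifies over GEOMETRIC points only, hence `K` algebraically closed; over `ℂ` this is the printed
«for all `t ∈ T`» of [MilneAV2008, I §8].) Banked capital toward an inhabited `DualPair (ofAbelianVariety A₀)` over
`Spec ℂ` on normal `T`; HC_CM is proved only modulo the 7 printed citations until rung 0 closes.

## References

* [MumfordAV1970] D. Mumford, *Abelian Varieties* (1970), §8 ((iv) ⇔ (i)) and §8 Theorem 1 (p. 77).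
* [MilneAV2008] J. S. Milne, *Abelian Varieties* (2008), I §8 (pp. 36–37).
* [GortzWedhorn2020] U. Görtz, T. Wedhorn, *Algebraic Geometry I*, 2nd ed. (2020), Section (4.7) (p. 135).
-/

noncomputable section

open CategoryTheory CategoryTheory.Limits AlgebraicGeometry MonoidalCategory CartesianMonoidalCategory

namespace Literature.AlgebraicGeometry.AbelianSchemes

namespace AbelianSchemeOver

open Literature.AlgebraicGeometry.Motives Literature.AlgebraicGeometry.AbelianVarieties
  Literature.AlgebraicGeometry.Modules

/-! ### §0 Bookkeeping: the scheme map of `fibreCongrIso` -/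

section FibreCongr

universe u

variable {S : Scheme.{u}} (A : AbelianSchemeOver S) {K : Type u} [Field K] {s₁ s₂ : Spec (.of K) ⟶ S}

/-- The transport ★ `fibreCongrIso` along an equality `s₁ = s₂` of base points commutes with the projections
`A_{sᵢ} → A`. [cite: GortzWedhorn2020, Section (4.7) (p. 135)] -/
@[reassoc]
theorem fibreCongrIso_hom_toSchemeHom_fst (h : s₁ = s₂) :
    AbelianVariety.Hom.toSchemeHom (A.fibreCongrIso h).hom ≫ pullback.fst A.X.hom s₂ = pullback.fst A.X.hom s₁ := by
  subst h
  simp only [fibreCongrIso, eqToIso_refl, Iso.refl_hom]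
  exact Category.id_comp _

end FibreCongr

/-! ### §1 The slice of `ℒ` at a rational point is homogeneous of rank one -/

section Slice

variable {K : Type} [Field K] (A₀ : AbelianVariety K) {T : Scheme.{0}} {f : T ⟶ Spec (.of K)}
  (ℒ : (AbelianSchemeOver.ofAbelianVariety A₀).RigidifiedLineBundle f)

/-- **The fibre of `A₀ ×_K T → T` at a RATIONAL point `t` of `T` (`t ≫ f = 𝟙`) is `A₀`**, as abelian varieties
over `K`, through an isomorphism whose underlying scheme map is the first projection
`(A₀ ×_K T) ×_T Spec K → A₀ ×_K T → A₀`: composite of ★ `fibreBaseChangeIso` (`(A_T)_t ≅ A_{t ≫ f}`), ★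
`fibreCongrIso` (`A_{t ≫ f} = A_𝟙`) and ★ `fibreIdIso` (`A_𝟙 ≅ A₀`). [cite: GortzWedhorn2020, Section (4.7) (p. 135)] -/
theorem exists_fibreIso_toSchemeHom_eq (t : Spec (.of K) ⟶ T) (ht : t ≫ f = 𝟙 _) :
    ∃ ψ : (((AbelianSchemeOver.ofAbelianVariety A₀).baseChange f).fibre t).toAbelianVariety ≅ A₀,
      AbelianVariety.Hom.toSchemeHom ψ.hom = pullback.fst (pullback.snd A₀.X.hom f) t ≫ pullback.fst A₀.X.hom f := by
  refine ⟨(AbelianSchemeOver.ofAbelianVariety A₀).fibreBaseChangeIso f t ≪≫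
    (AbelianSchemeOver.ofAbelianVariety A₀).fibreCongrIso ht ≪≫ fibreIdIso (AbelianSchemeOver.ofAbelianVariety A₀), ?_⟩
  have h1 := (AbelianSchemeOver.ofAbelianVariety A₀).fibreBaseChangeIso_hom_toSchemeHom_fst f t
  have h2 := (AbelianSchemeOver.ofAbelianVariety A₀).fibreCongrIso_hom_toSchemeHom_fst ht
  have h3 : AbelianVariety.Hom.toSchemeHom (fibreIdIso (AbelianSchemeOver.ofAbelianVariety A₀)).hom =
      pullback.fst A₀.X.hom (𝟙 _) :=
    fibreIdToGrpIso_hom_left (AbelianSchemeOver.ofAbelianVariety A₀)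
  change AbelianVariety.Hom.toSchemeHom ((AbelianSchemeOver.ofAbelianVariety A₀).fibreBaseChangeIso f t).hom ≫
      AbelianVariety.Hom.toSchemeHom ((AbelianSchemeOver.ofAbelianVariety A₀).fibreCongrIso ht).hom ≫
        AbelianVariety.Hom.toSchemeHom (fibreIdIso (AbelianSchemeOver.ofAbelianVariety A₀)).hom = _
  rw [h3]
  exact (congrArg (AbelianVariety.Hom.toSchemeHom
    ((AbelianSchemeOver.ofAbelianVariety A₀).fibreBaseChangeIso f t).hom ≫ ·) h2).trans h1

/-- **The pull-back of a fibrewise-`Pic⁰` rigidified line bundle along ANY slice at a rational point is homogeneous**: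
for `K` algebraically closed, `t : Spec K → T` with `t ≫ f = 𝟙` and `s : A₀ → A₀ ×_K T` with `s ≫ pr₁ = 𝟙`,
`s ≫ pr₂ = π ≫ t`, the module `s^* ℒ` satisfies `t_P^*(s^*ℒ) ≅ s^*ℒ` for every `P ∈ A₀(K)` ([MumfordAV1970, §8]:
`ℒ_t ∈ Pic⁰` read through `(A_T)_t ≅ A₀`). [cite: MumfordAV1970, §8 ((iv) ⇔ (i))] [cite: MilneAV2008, I §8 (pp. 36–37)] -/
theorem isHomogeneous_pullback_of_fibrewisePicZero [IsAlgClosed K] (hℒ : ℒ.FibrewisePicZero)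
    (t : Spec (.of K) ⟶ T) (ht : t ≫ f = 𝟙 _) (s : A₀.X.left ⟶ pullback A₀.X.hom f)
    (hs₁ : s ≫ pullback.fst A₀.X.hom f = 𝟙 _) (hs₂ : s ≫ pullback.snd A₀.X.hom f = A₀.X.hom ≫ t) :
    IsHomogeneous A₀ ((Scheme.Modules.pullback s).obj ℒ.L) := by
  -- the scheme map of `ψ : (A_T)_t ≅ A₀` followed by the slice is the first projection `(A_T)_t → A_T`
  obtain ⟨ψ, hψ⟩ := exists_fibreIso_toSchemeHom_eq A₀ t ht
  have hw : AbelianVariety.Hom.toSchemeHom ψ.hom ≫ A₀.X.hom =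
      pullback.snd (pullback.snd A₀.X.hom f) t := by
    have hw' := Over.w ψ.hom.hom.hom.hom
    exact hw'
  have hcomp : AbelianVariety.Hom.toSchemeHom ψ.hom ≫ s =
      pullback.fst (pullback.snd A₀.X.hom f) t := by
    apply pullback.hom_ext
    · calc (AbelianVariety.Hom.toSchemeHom ψ.hom ≫ s) ≫ pullback.fst A₀.X.hom f
          = AbelianVariety.Hom.toSchemeHom ψ.hom ≫ s ≫ pullback.fst A₀.X.hom f :=
            Category.assoc _ _ _
        _ = AbelianVariety.Hom.toSchemeHom ψ.hom := by
            rw [hs₁]; exact Category.comp_id _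
        _ = pullback.fst (pullback.snd A₀.X.hom f) t ≫ pullback.fst A₀.X.hom f := hψ
    · calc (AbelianVariety.Hom.toSchemeHom ψ.hom ≫ s) ≫ pullback.snd A₀.X.hom f
          = AbelianVariety.Hom.toSchemeHom ψ.hom ≫ s ≫ pullback.snd A₀.X.hom f :=
            Category.assoc _ _ _
        _ = (AbelianVariety.Hom.toSchemeHom ψ.hom ≫ A₀.X.hom) ≫ t := by
            rw [hs₂]; exact (Category.assoc _ _ _).symm
        _ = pullback.snd (pullback.snd A₀.X.hom f) t ≫ t := congrArg (· ≫ t) hw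
        _ = pullback.fst (pullback.snd A₀.X.hom f) t ≫ pullback.snd A₀.X.hom f := pullback.condition.symm
  -- `ψ^*(s^*ℒ) ≅ (ψ ≫ s)^*ℒ = pr₁^*ℒ = ℒ_t`, homogeneous on `(A_T)_t` by hypothesis
  have e : (Scheme.Modules.pullback (AbelianVariety.Hom.toSchemeHom ψ.hom)).obj
        ((Scheme.Modules.pullback s).obj ℒ.L) ≅ ℒ.fibreModule t :=
    (Scheme.Modules.pullbackComp _ _).app ℒ.L ≪≫ (Scheme.Modules.pullbackCongr hcomp).app ℒ.L
  exact (isHomogeneous_pullback_iff_of_iso ψ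
    ((Scheme.Modules.pullback s).obj ℒ.L)).1 ((isHomogeneous_iff_of_iso _ e).2 (hℒ K t))

/-- The pull-back of `ℒ` along any map is again a line bundle (★ `hasRank_pullback`). [cite: MilneAV2008, I §8 (pp. 36–37)] -/
theorem hasRank_pullback_L {Y : Scheme.{0}} (s : Y ⟶ pullback A₀.X.hom f) :
    HasRank ((Scheme.Modules.pullback s).obj ℒ.L) 1 :=
  hasRank_pullback s ℒ.hasRank_one

/-- **(ε) The slice `ℒ|_{A₀ × {t₀}}` at a rational point `t₀ : 𝟙 ⟶ T` of `Over (Spec K)` is HOMOGENEOUS** (`K`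
algebraically closed) — the cartesian-monoidal spelling `((ρ_ A₀.X).inv ≫ A₀.X ◁ t₀).left : A₀ → A₀ ×_K T` of the slice
(`(A_T).left = (A₀.X ⊗ T).left` definitionally): `t_P^* ℒ_{t₀} ≅ ℒ_{t₀}` for all `P ∈ A₀(K)`, i.e. `ℒ_{t₀} ∈ Pic⁰(A₀)`
in the form consumed by ★ `exists_detClass_eq_detClass_pullback_sliceAt`. [cite: MumfordAV1970, §8 ((iv) ⇔ (i))]
[cite: MilneAV2008, I §8 (pp. 36–37)] -/
theorem isHomogeneous_slice_of_fibrewisePicZero [IsAlgClosed K] (hℒ : ℒ.FibrewisePicZero)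
    (t₀ : 𝟙_ (SchemeOver K) ⟶ (Over.mk f : SchemeOver K)) :
    IsHomogeneous A₀ ((Scheme.Modules.pullback ((ρ_ A₀.X).inv ≫ A₀.X ◁ t₀).left).obj ℒ.L) := by
  have h1 : ((ρ_ A₀.X).inv ≫ A₀.X ◁ t₀) ≫ fst A₀.X (Over.mk f) = 𝟙 A₀.X := by
    rw [Category.assoc, whiskerLeft_fst, rightUnitor_inv_fst]
  have h2 : ((ρ_ A₀.X).inv ≫ A₀.X ◁ t₀) ≫ snd A₀.X (Over.mk f) = toUnit A₀.X ≫ t₀ := by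
    rw [Category.assoc, whiskerLeft_snd, rightUnitor_inv_snd_assoc]
  exact isHomogeneous_pullback_of_fibrewisePicZero A₀ ℒ hℒ t₀.left (Over.w t₀) _
    (congrArg CommaMorphism.left h1) (congrArg CommaMorphism.left h2)

/-- (ε, rank clause) The slice `ℒ|_{A₀ × {t₀}}` is a line bundle. [cite: MilneAV2008, I §8 (pp. 36–37)] -/
theorem hasRank_slice (t₀ : 𝟙_ (SchemeOver K) ⟶ (Over.mk f : SchemeOver K)) :
    HasRank ((Scheme.Modules.pullback ((ρ_ A₀.X).inv ≫ A₀.X ◁ t₀).left).obj ℒ.L) 1 :=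
  hasRank_pullback_L A₀ ℒ _

/-- **(ε′) The slice at an `AlgPoints` point `x : Spec K → T`, `lift`-spelling** `(lift (𝟙 A₀.X) (toSpecOver A₀.X ≫ x)).left`
(the ★ `PoincareSheafSlicesPoints` form; `K` algebraically closed): `ℒ|_{A₀ × {x}}` is homogeneous.
[cite: MumfordAV1970, §8 ((iv) ⇔ (i))] [cite: MilneAV2008, I §8 (pp. 36–37)] -/
theorem isHomogeneous_sliceAt_of_fibrewisePicZero [IsAlgClosed K] (hℒ : ℒ.FibrewisePicZero)
    (x : AlgPoints (Over.mk f : SchemeOver K) K) :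
    IsHomogeneous A₀ ((Scheme.Modules.pullback
      (lift (𝟙 A₀.X) (toSpecOver A₀.X ≫ x) : A₀.X ⟶ A₀.X ⊗ (Over.mk f : SchemeOver K)).left).obj ℒ.L) := by
  have hx : x.left ≫ f = 𝟙 (Spec (.of K)) := by
    have := Over.w x
    simpa only [Over.mk_hom, Algebra.algebraMap_self, CommRingCat.ofHom_id, Spec.map_id] using this
  have h1 : lift (𝟙 A₀.X) (toSpecOver A₀.X ≫ x) ≫ fst A₀.X (Over.mk f) = 𝟙 A₀.X := lift_fst _ _
  have h2 : lift (𝟙 A₀.X) (toSpecOver A₀.X ≫ x) ≫ snd A₀.X (Over.mk f) = toSpecOver A₀.X ≫ x := lift_snd _ _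
  exact isHomogeneous_pullback_of_fibrewisePicZero A₀ ℒ hℒ x.left hx _
    (congrArg CommaMorphism.left h1) (congrArg CommaMorphism.left h2)

/-- (ε′, rank clause) The slice at an `AlgPoints` point is a line bundle. [cite: MilneAV2008, I §8 (pp. 36–37)] -/
theorem hasRank_sliceAt (x : AlgPoints (Over.mk f : SchemeOver K) K) :
    HasRank ((Scheme.Modules.pullback
      (lift (𝟙 A₀.X) (toSpecOver A₀.X ≫ x) : A₀.X ⟶ A₀.X ⊗ (Over.mk f : SchemeOver K)).left).obj ℒ.L) 1 :=
  hasRank_pullback_L A₀ ℒ _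

end Slice

end AbelianSchemeOver

end Literature.AlgebraicGeometry.AbelianSchemes

end
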